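import Mathlib
import HarnessLib
import Summits.Ventures.CertifiedManyBodySolver.Theses.M3x2EdgeSplit
import Literature.MathematicalPhysics.QuantumLattice.HubbardNNNHoppingWindowCertificateD4
import Summits.Ventures.CertifiedManyBodySolver.Theorems.M3x2EdgeSplitLowerEdge_ge_m83o100SlackAbsorb

/-!
# Line `fo-dual-rounding` (rev 4) — a kernel-level SLACK READER for first-order duals with rigorous rounding
(crux-plan skeleton for `M3x2EdgeSplit.LowerEdge_ge_m83o100`; team lb-dual, cell hub-lb; planner hub-lb-dual-plan-2 g0, rev 4 by g1)
(= stmt-Ventures-22024, the ×2 declared split, MET BY VALUE outside Lean by #529; −4/5 original for stmt-Ventures-21721 at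
`Cruxes/LowerEdge_ge_m4o5/Lines/fo_dual_rounding.lean` — identical but for the constant and stub 3's grade)
HONEST FRAMING: a skeleton is a typed plan with sorried stubs, not a bound. No summit statement is proved
here; the only certified M3 lower row at `t' = 0` remains CERTIFIED #529 (`lo = −0.8295699476`, first-order
ADMM dual + exact repair, a claim node), `0.0296` below `−4/5` and `4.3·10⁻⁴` above `−83/100`. Nothing here
predicts superconductivity.

REV 4 (2026-08-28, hub-lb-dual-plan-2 g1) = THE ONE PERMITTED RE-REGISTRATION (captain ruling «skeleton of record =
status quo frozen», cell STATUS 06:28:34Z, obligation O1; recipe hub-lb-sym-eng-3 07:49:48Z): the two SOUNDNESS stubs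
are DISCHARGED by theorems now LANDED in `Theorems/` — `stub_wardWindowSound := Theorems.WardSlotM83.stub_wardWindowSound`
(p612562, file `Theorems/M3x2EdgeSplitLowerEdge_ge_m83o100WardWindowSound.lean`, hub-lb-sym-eng-3; proof term
`Literature…HubbardNNNHoppingWindowCertificateWardD4TL.energyDensityTT'_ge_of_wardD4_window_certificate`, W1∘W2∘W3,
statement text = hub-lb-sym-plan-2's `wardk`, first sorry-free chain = hub-lb-dual-plan-1's `dualreplay`) and
`stub_slackAbsorb := Theorems.WardSlotM83.stub_slackAbsorb` (p613744, file `Theorems/M3x2EdgeSplitLowerEdge_ge_m83o100SlackAbsorb.lean`,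
a one-line re-export of the −4/5 item's `Theorems.WardSlot.stub_slackAbsorb`, p613156 = hub-lb-sym-ref-1's `SlackAbsorb.lean`
8686c191df574d56 landed verbatim by sym-eng-3). Both landed statements are VERBATIM (rfl-equal) copies of §1 below
(hub-lb-dual-ref-2 `BindO2.lean` 34d72a1f2b42d62c: four `rfl` + composition, axioms {propext, Classical.choice,
Quot.sound}), so the discharge is by definitional unfolding. NOTHING ELSE CHANGED: §1 is byte-identical to rev 3
(sha 74e9a7f66a0c), stub 3 (`stub_nearCert_m83o100`, name · signature · docstring) is byte-identical, §3's composition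
is unchanged. After rev 4 the REGISTERED STUB SET is {`stub_nearCert_m83o100`} — the VALUE stub, MET BY VALUE outside
Lean by CERTIFIED #529 (margin 4.3·10⁻⁴) and UN-LANDED: what remains for a prover on this item is a kernel-replayable
EDITION of a `≥ −83/100` certificate (checker work, see VALUE-STUB INTERFACE below), not mathematics of the reader.

REV 3 = the cell's two rulings applied to rev 2:
* RULING (crit-3 VERDICT-3 #3 (C) 05:37:33Z; crit-1 owner record 05:40:18Z/05:40:45Z): the `SU(2)`-Ward slot is
  ONE Lean text — pen sym-plan-2, line `wardk` (W1 generic-sector torus certificate, W2 Ward × `D₄` torus theorem on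
  the `N`-particle sector, W3 torus → TL); dual-plan-2 DROPS its own Ward theorem and IMPORTS that one. Done here:
  `WardD4Identity` and `WardD4WindowSound` below are VERBATIM copies of wardk.lean's (sha256/12 of the copied
  source text: `f37c52ff543c` / `82619db2fd6a`), kept as local defs ONLY because `Cruxes/…/Lines/*.lean` workfiles are not
  importable modules on the farm (`lean check` → rc 75 `unbuilt:….Lines.wardk`); the single stub
  `stub_wardWindowSound : WardD4WindowSound` is «wardk W1∘W2∘W3» and is discharged by ONE line (`exact` that
  theorem) the day wardk's text lands in `Theorems/` or `Literature/`. No second Ward theorem is filed.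
* S-R2 (dual-ref-2 05:43:25Z, CERT-SDP §2.3′ (τ1)/(τ3)): the slack charge must name its normalisation. Done here:
  the Gram generators `O k i` are ARBITRARY window operators shipped WITH weights `r k i` and SOS proofs
  `(r k i)² • 1 − (O k i)ᴴ (O k i) ⪰ 0` (i.e. `‖O k i‖ ≤ r k i`), and a PSD floor `δ_k` on block `k` costs EXACTLY
  `δ_k · Σ_i (r k i)²` — (τ1) ladder words: `r = 1` (`norm_ladderWord_le_one`), cost `δ_k · dim_k`; (τ3) integer-
  adapted `D₄ × SU(2)hw` generators `b_i = Σ_w B_iw w`: `r_i = ‖B_i‖₁`, cost `δ_k · Σ_i ‖B_i‖₁²`; mode gram (exact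
  `LᴴL`, certc K40, #529): `δ = 0`, no charge. `τ` is certificate DATA, never an assumption of the reader.

THE LINE. wardk's reader (`WardD4WindowSound`) is, like the tree's `energyDensityTT'_ge_of_window_certificate_d4`,
an ANY-TIME bound — any multipliers give `c − Σₖ ‖aₖ‖ ≤ e(t,t',U,n)` (pdopt `E(z) = −b·z − ‖q + Aᵀz‖₁`, certsdp
`bound = c₀ + p[norm] + λ·b − Σ|pᵢ|ρᵢ`) — but it wants the Gram multiplier EXACTLY PSD. The Jansson–Chaykin–Keil
mechanism (`Literature.Computation.Certificates.JanssonChaykinKeil.lmiForm_bound`: a multiplier PSD only up to a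
certified `λ_min`-enclosure `−δ` still certifies, at the a-priori primal cost `δ ·` (trace bound)) has no
counterpart in any tree or wardk window theorem. `stub_slackAbsorb` adds it: with it a ROUNDED FIRST-ORDER DUAL
ITERATE (exact-ℚ multipliers, a PSD floor `−δ_k` per block from an `LDLᵀ`/Gershgorin/`λ_min` enclosure, residual
in `ℓ¹`) is a certificate with NO exact Cholesky and NO interior-point solve (crit-3 δ1 option 2; certc's exact
`LLᵀ` path is the `δ = 0` instance — an alternative reader, not a prerequisite). The crux then TRANSFERS to the
finite statement `stub_nearCert_m83o100`: a near-certificate of value `≥ −83/100` exists at `(t,t',U,n) = (1,0,8,7/8)`.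

STUBS (rev 4: ONE registered stub = the only sorry of this file):
* `stub_wardWindowSound` [DISCHARGED p612562] `WardD4WindowSound` — wardk's W1∘W2∘W3, `:= Theorems.WardSlotM83.stub_wardWindowSound`.
* `stub_slackAbsorb`     [DISCHARGED p613744] `WardD4WindowSound → WardSlackWindowBound` — JCK Lemma 3.1, `:= Theorems.WardSlotM83.stub_slackAbsorb`.
* `stub_nearCert_m83o100`  [L, REGISTERED]    `NearCertWardSlack_m83o100` — the TRANSFER target `C⁺` (VALUE stub, met by value by #529).
COMPOSITION (no sorry): `exists_lowerRow_of_stubs : stub₁ → stub₂ → stub₃ → ∃ lo ≥ −83/100, M3EnergyLowerRow 0 lo`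
and `LowerEdge_ge_m83o100_of : M3x2EdgeSplit.LowerEdge_ge_m83o100` — the crux BY NAME from the declared stubs.

VALUE-STUB INTERFACE (how an edition inhabits `NearCertWardSlack_m83o100`, binder by binder; glue in the tree or offered):
`_hZ` (per-block `Z k + δ_k•1 ⪰ 0`): mode gram `Z k = Lᴴ L`, `δ_k = 0` by `Matrix.posSemidef_conjTranspose_mul_self`
(certc / #529 class), or factor + max-rowsum slack `δ_k := g_k` (hub-lb-dual-plan-1 `PsdOfFactorRowsum`,
`Cruxes/LowerEdge_ge_m4o5/Lines/dualreplay.lean`, proved), or exact `LDLᵀ` (`psdCheck_sound`, lb-chord); `_hO` (generator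
norms): ladder words `r = 1` (`norm_ladderWord_le_one`), symmetry-adapted ℂ-combinations `r := Σ|coeff|` (hub-lb-dual-ref-2
`G2prime.lean` 757bab12112d52b2: `hO_wordCombination`, kernel-checked, offered for verbatim landing); the IDENTITY
`WardD4Identity …` (an equation in `FermionOp Λ'`): a verified CAR normal-orderer — lb-sym `Lines/symreplay.lean` S1–S4
(`SymCheckSound : ∀ K, symCheck K = true → WardD4CertGe (symValue K)`, pen hub-lb-sym-plan-1, unregistered workfile; exact
Gram, `δ = 0`) — this is the CHECKER WORK and the binding cost (≈ 2.5×10⁸ pair normal-orderings at E₁ class, hub-lb-sym-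
ref-2; #529's own footprint is MENU-class, 1 660 885 Ward rows, beyond in-kernel replay today); the inequality
`−83/100 ≤ c − Σ‖a_k‖ − Σ_k δ_k Σ_i r²`: `norm_num` on shipped rationals. Whole-stub dischargers already PROVED in workfiles:
lb-chord `Cruxes/LowerEdge_ge_m4o5/Lines/clique_sparse_sos.lean` (hub-lb-chord-plan-2) `nearCertGe_of_cliqueWardCertGe :
CliqueWardCertGe q → NearCertWardSlackGe q` with `cliqueWardCertGe_iff : CliqueWardCertGe q ↔ WardD4CertGe q` and the
monotonicity `nearCertWardSlackGe_mono` — so ANY exact (`δ = 0`) Ward × `D₄` certificate of value `q ≥ −83/100` in wardk's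
sense `WardD4CertGe q`, however produced (symreplay `SymCert`, clique-sparse SOS, certc mode gram), inhabits this stub
after the import swap (`NearCertWardSlackGe (−83/100)` and `NearCertWardSlack_m83o100` have the same body); the `δ > 0`
slack is what a ROUNDED first-order iterate needs in addition — #529's ADMM dual was REPAIRED to exact feasibility
(`δ = 0`), a re-rounded XSTAR/MENU export would instead price its PSD floors `Σ_k δ_k Σ_i r_ki² ≤ 4.3·10⁻⁴` (crit-1 P2).
No kernel-replayable −83/100 edition exists yet (MENU-LITE #513 = −0.8315 < −0.83); the interface is recorded for the
day one does, and is word-for-word the −4/5 item's.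
-/

noncomputable section

namespace Summit.Ventures.CertifiedManyBodySolver.Cruxes.LowerEdge_ge_m83o100.FoDualRounding

open Matrix Finset
open Literature.MathematicalPhysics.QuantumLattice
open Literature.MathematicalPhysics.QuantumLattice.HubbardWave0
open Literature.MathematicalPhysics.QuantumLattice.ThermodynamicLimit
open Literature.Probability.LatticeModels
open Literature.MathematicalPhysics.QuantumManyBody.StateRelaxation
open scoped ComplexOrder BigOperators

/-! ## §1 Statements -/

/-- **VERBATIM COPY of `WardK.WardD4Identity` (Cruxes/LowerEdge_ge_m4o5/Lines/wardk.lean, sym-plan-2 = pen of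
record for the Ward slot).** The `SU(2)`-Ward × affine-`D₄` window identity in `𝔄_{Λ'}` for the `t–t'` Hubbard
interaction at target density `n`: ONE multiplier `μ` on the total site density and the two Ward null families
`Σ_r (S⁺_{Λ'} X_r − X_r S⁺_{Λ'})`, `Σ_r (S⁻_{Λ'} X'_r − X'_r S⁻_{Λ'})` next to the null terms of
`groundEnergy_hubbardTorusTT'_div_ge_of_window_certificate_d4`. (Local copy only because Lines workfiles are not
importable on the farm; replace by the import when wardk lands.) -/
def WardD4Identity (t t' U n : ℝ) {Λ Λ' : Finset (Site 2)} (hΛ : Λ ⊆ Λ')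
    (h0 : thicken ({0} : Finset (Site 2)) 1 ⊆ Λ') (hz : (0 : Site 2) ∈ Λ') (μ : ℝ)
    {m : Type} [Fintype m] [DecidableEq m] (Λm : Matrix m m ℂ) (O : m → FermionOp Λ')
    {κ : Type} (s : Finset κ) (B : κ → FermionOp Λ)
    {ι : Type} (tt : Finset ι) (γ : ι → DihedralGroup 4) (wv : ι → Site 2)
    (hsh : ∀ l, d4ShiftSet (γ l) (wv l) Λ ⊆ Λ') (Y : ι → FermionOp Λ)
    {ρ : Type} (u : Finset ρ) (b : ρ → ℂ) (cw : ρ → List (Orb (PolySite Λ') × Bool))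
    {θ : Type} (wp : Finset θ) (Xp : θ → FermionOp Λ')
    {θ' : Type} (wm : Finset θ') (Xm : θ' → FermionOp Λ')
    {δ : Type} (ah : Finset δ) (dc : δ → ℝ) (V : δ → FermionOp Λ')
    {κ'' : Type} (w : Finset κ'') (a : κ'' → ℂ) (word : κ'' → List (Orb (PolySite Λ') × Bool))
    (c : ℝ) : Prop :=
  fermionEmbed (PolySite.incl h0) ((hubbardTTPrimeFermionInteraction t t' U).meanEnergyObs 1) -
      (c : ℂ) • (1 : FermionOp Λ') -
      ((μ : ℝ) : ℂ) • (nAt 0 hz 0 + nAt 0 hz 1 - ((n : ℝ) : ℂ) • (1 : FermionOp Λ')) =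
    gramForm Λm O +
      (∑ k ∈ s, ((hubbardTTPrimeFermionInteraction t t' U).localHamiltonian Λ' * fermionEmbed (PolySite.incl hΛ) (B k) -
          fermionEmbed (PolySite.incl hΛ) (B k) * (hubbardTTPrimeFermionInteraction t t' U).localHamiltonian Λ') +
        ∑ l ∈ tt, (fermionEmbed (PolySite.incl (hsh l)) (fermionEmbed (PolySite.d4Emb (γ l) (wv l) Λ) (Y l)) -
          fermionEmbed (PolySite.incl hΛ) (Y l)) +
        ∑ j ∈ u, b j • ladderWord (cw j) +
        ∑ r ∈ wp, ((spinPlus : FermionOp Λ') * Xp r - Xp r * (spinPlus : FermionOp Λ')) +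
        ∑ r ∈ wm, ((spinMinus : FermionOp Λ') * Xm r - Xm r * (spinMinus : FermionOp Λ'))) +
      (∑ m' ∈ ah, ((dc m' : ℝ) : ℂ) • ((V m')ᴴ - V m') + ∑ k ∈ w, a k • ladderWord (word k))

/-- **VERBATIM COPY of `WardK.WardD4WindowSound` (wardk W3 target = W1∘W2∘W3): Ward × `D₄` window certificate ⇒
`c − Σₖ ‖aₖ‖ ≤ energyDensityTT' t t' U n`** (`0 ≤ U`, `0 ≤ n < 2`, `thicken Λ 1 ⊆ Λ'`), Gram multiplier `Λm`
EXACTLY PSD, generators `O : m → FermionOp Λ'` arbitrary. -/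
def WardD4WindowSound : Prop :=
  ∀ (t t' U : ℝ), 0 ≤ U → ∀ (n : ℝ), 0 ≤ n → n < 2 →
  ∀ (Λ Λ' : Finset (Site 2)) (hΛ : Λ ⊆ Λ') (_h8 : thicken Λ 1 ⊆ Λ')
    (h0 : thicken ({0} : Finset (Site 2)) 1 ⊆ Λ') (hz : (0 : Site 2) ∈ Λ')
    (μ : ℝ)
    (m : Type) (_ : Fintype m) (_ : DecidableEq m) (Λm : Matrix m m ℂ) (_hΛm : Λm.PosSemidef)
    (O : m → FermionOp Λ')
    (κ : Type) (s : Finset κ) (B : κ → FermionOp Λ)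
    (ι : Type) (tt : Finset ι) (γ : ι → DihedralGroup 4) (wv : ι → Site 2)
    (hsh : ∀ l, d4ShiftSet (γ l) (wv l) Λ ⊆ Λ') (Y : ι → FermionOp Λ)
    (ρ : Type) (u : Finset ρ) (b : ρ → ℂ) (cw : ρ → List (Orb (PolySite Λ') × Bool))
    (_hcw : ∀ j ∈ u, ladderCharge (cw j) ≠ 0 ∨ ladderSpinCharge (cw j) ≠ 0)
    (θ : Type) (wp : Finset θ) (Xp : θ → FermionOp Λ')
    (θ' : Type) (wm : Finset θ') (Xm : θ' → FermionOp Λ')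
    (δ : Type) (ah : Finset δ) (dc : δ → ℝ) (V : δ → FermionOp Λ')
    (κ'' : Type) (w : Finset κ'') (a : κ'' → ℂ) (word : κ'' → List (Orb (PolySite Λ') × Bool))
    (c : ℝ),
    WardD4Identity t t' U n hΛ h0 hz μ Λm O s B tt γ wv hsh Y u b cw wp Xp wm Xm ah dc V w a word c →
    c - ∑ k ∈ w, ‖a k‖ ≤ energyDensityTT' t t' U n

/-- **Statement of stub 2's conclusion — the SLACK READER (JCK Lemma 3.1 in the window algebra, normalisation
EXPLICIT per S-R2).** Same identity `WardD4Identity`, but the Gram part is a finite FAMILY of blocks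
`k : β` with multipliers `Z k` that are only NEARLY PSD — `Z k + δ_k • 1 ⪰ 0`, `0 ≤ δ_k` (a certified
`λ_min`-enclosure; `Z k` itself exact-ℚ in practice) — entered as `Λm := blockDiagonal' Z` on the generator
family `(k,i) ↦ O k i`, where every generator is shipped with a weight `r k i` and an SOS proof of
`‖O k i‖ ≤ r k i` in the form `(r k i)² • 1 − (O k i)ᴴ (O k i) ⪰ 0`. PRICE: `Σ_k δ_k · Σ_i (r k i)²`
(the state value of `(O k i)ᴴ (O k i)` is `≤ (r k i)²`). Conclusion:
`c − Σₖ ‖aₖ‖ − Σ_k δ_k Σ_i (r k i)² ≤ energyDensityTT' t t' U n`. -/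
def WardSlackWindowBound : Prop :=
  ∀ (t t' U : ℝ), 0 ≤ U → ∀ (n : ℝ), 0 ≤ n → n < 2 →
  ∀ (Λ Λ' : Finset (Site 2)) (hΛ : Λ ⊆ Λ') (_h8 : thicken Λ 1 ⊆ Λ')
    (h0 : thicken ({0} : Finset (Site 2)) 1 ⊆ Λ') (hz : (0 : Site 2) ∈ Λ')
    (μ : ℝ)
    (β : Type) (_ : Fintype β) (_ : DecidableEq β) (mb : β → Type) (_ : ∀ k, Fintype (mb k))
    (_ : ∀ k, DecidableEq (mb k))
    (Z : (k : β) → Matrix (mb k) (mb k) ℂ) (δs : β → ℝ) (_hδ : ∀ k, 0 ≤ δs k)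
    (_hZ : ∀ k, (Z k + ((δs k : ℝ) : ℂ) • (1 : Matrix (mb k) (mb k) ℂ)).PosSemidef)
    (O : (k : β) → mb k → FermionOp Λ') (r : (k : β) → mb k → ℝ)
    (_hO : ∀ k i, ((((r k i) ^ 2 : ℝ) : ℂ) • (1 : FermionOp Λ') - (O k i)ᴴ * O k i).PosSemidef)
    (κ : Type) (s : Finset κ) (B : κ → FermionOp Λ)
    (ι : Type) (tt : Finset ι) (γ : ι → DihedralGroup 4) (wv : ι → Site 2)
    (hsh : ∀ l, d4ShiftSet (γ l) (wv l) Λ ⊆ Λ') (Y : ι → FermionOp Λ)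
    (ρ : Type) (u : Finset ρ) (b : ρ → ℂ) (cw : ρ → List (Orb (PolySite Λ') × Bool))
    (_hcw : ∀ j ∈ u, ladderCharge (cw j) ≠ 0 ∨ ladderSpinCharge (cw j) ≠ 0)
    (θ : Type) (wp : Finset θ) (Xp : θ → FermionOp Λ')
    (θ' : Type) (wm : Finset θ') (Xm : θ' → FermionOp Λ')
    (δ : Type) (ah : Finset δ) (dc : δ → ℝ) (V : δ → FermionOp Λ')
    (κ'' : Type) (w : Finset κ'') (a : κ'' → ℂ) (word : κ'' → List (Orb (PolySite Λ') × Bool))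
    (c : ℝ),
    WardD4Identity t t' U n hΛ h0 hz μ (Matrix.blockDiagonal' Z) (fun p : (k : β) × mb k => O p.1 p.2)
      s B tt γ wv hsh Y u b cw wp Xp wm Xm ah dc V w a word c →
    c - ∑ k ∈ w, ‖a k‖ - ∑ k, δs k * ∑ i, (r k i) ^ 2 ≤ energyDensityTT' t t' U n

/-- **Statement of stub 3 — the transfer target `C⁺`: a NEAR-CERTIFICATE OF VALUE `≥ −83/100` EXISTS at
`(t,t',U,n) = (1,0,8,7/8)`**, in checker normal form (all index sets finite ordinals): windows `Λ ⊆ Λ'`,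
ONE total-density multiplier `μ`, Gram blocks `Z k` (`k < nb`, sizes `msz k`) with PSD floors `δ_k ≥ 0`
(`Z k + δ_k • 1 ⪰ 0`), generators `O k i` with weights `r k i` and SOS norm proofs, `[H', ·]`-, `D₄`-, charged-
word-, `S⁺`/`S⁻`-WARD- and anti-Hermitian null data, residual words with coefficients `a`, satisfying
`WardD4Identity` EXACTLY, and `−83/100 ≤ c − Σₖ ‖aₖ‖ − Σ_k δ_k Σ_i (r k i)²`. STRONGER than the crux; it
is what the engines produce (FO dual iterate → exact-ℚ multipliers → per-block `λ_min` floor → `ℓ¹` residual). -/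
def NearCertWardSlack_m83o100 : Prop :=
  ∃ (Λ Λ' : Finset (Site 2)) (hΛ : Λ ⊆ Λ') (_h8 : thicken Λ 1 ⊆ Λ')
    (h0 : thicken ({0} : Finset (Site 2)) 1 ⊆ Λ') (hz : (0 : Site 2) ∈ Λ')
    (μ : ℝ)
    (nb : ℕ) (msz : Fin nb → ℕ) (Z : (k : Fin nb) → Matrix (Fin (msz k)) (Fin (msz k)) ℂ)
    (δs : Fin nb → ℝ) (_hδ : ∀ k, 0 ≤ δs k)
    (_hZ : ∀ k, (Z k + ((δs k : ℝ) : ℂ) • (1 : Matrix (Fin (msz k)) (Fin (msz k)) ℂ)).PosSemidef)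
    (O : (k : Fin nb) → Fin (msz k) → FermionOp Λ') (r : (k : Fin nb) → Fin (msz k) → ℝ)
    (_hO : ∀ k i, ((((r k i) ^ 2 : ℝ) : ℂ) • (1 : FermionOp Λ') - (O k i)ᴴ * O k i).PosSemidef)
    (ns : ℕ) (B : Fin ns → FermionOp Λ)
    (nt : ℕ) (γ : Fin nt → DihedralGroup 4) (wv : Fin nt → Site 2)
    (hsh : ∀ l, d4ShiftSet (γ l) (wv l) Λ ⊆ Λ') (Y : Fin nt → FermionOp Λ)
    (nu : ℕ) (b : Fin nu → ℂ) (cw : Fin nu → List (Orb (PolySite Λ') × Bool))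
    (_hcw : ∀ j ∈ (Finset.univ : Finset (Fin nu)), ladderCharge (cw j) ≠ 0 ∨ ladderSpinCharge (cw j) ≠ 0)
    (np : ℕ) (Xp : Fin np → FermionOp Λ') (nm' : ℕ) (Xm : Fin nm' → FermionOp Λ')
    (na : ℕ) (dc : Fin na → ℝ) (V : Fin na → FermionOp Λ')
    (nw : ℕ) (a : Fin nw → ℂ) (word : Fin nw → List (Orb (PolySite Λ') × Bool))
    (c : ℝ),
    WardD4Identity 1 0 8 (7 / 8) hΛ h0 hz μ (Matrix.blockDiagonal' Z)
      (fun p : (k : Fin nb) × Fin (msz k) => O p.1 p.2) Finset.univ B Finset.univ γ wv hsh Y Finset.univ b cw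
      Finset.univ Xp Finset.univ Xm Finset.univ dc V Finset.univ a word c ∧
    (-83 / 100 : ℝ) ≤ c - ∑ k, ‖a k‖ - ∑ k, δs k * ∑ i, (r k i) ^ 2

/-! ## §2 Stubs — 1 and 2 DISCHARGED by landed theorems (rev 4); 3 is the ONE registered stub (the only sorry) -/

/-- **Stub 1 [DISCHARGED, rev 4] — wardk's Ward × `D₄` window soundness theorem (W1∘W2∘W3; statement pen
hub-lb-sym-plan-2; cell ruling: ONE text).** LANDED as `Theorems.WardSlotM83.stub_wardWindowSound` (p612562, file
`Theorems/M3x2EdgeSplitLowerEdge_ge_m83o100WardWindowSound.lean`, hub-lb-sym-eng-3), whose proof term is the Literature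
theorem `HubbardNNNHoppingWindowCertificateWardD4TL.energyDensityTT'_ge_of_wardD4_window_certificate` (chain
`HubbardTorusGenericSectorCertificate` W1 → `HubbardNNNHoppingWindowCertificateWardD4` W2 → `HubbardTTPrimeTorusFamilyTransport`
W3 → `…WardD4TL`, all ACCEPTED; first sorry-free in-cell chain: hub-lb-dual-plan-1 `Lines/dualreplay.lean`
`wardD4WindowSound_holds`). The landed statement is a verbatim copy of §1's `WardD4WindowSound` over a verbatim copy of
`WardD4Identity` (namespace `Theorems.WardSlotM83`; hub-lb-dual-ref-2 `BindO2.lean`: `rfl`), so the term below elaborates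
by definitional unfolding; axioms {propext, Classical.choice, Quot.sound}. No longer a registered stub.
[cite: LiebTwoTheorems1989, Thm 2; Han2020Bootstrap, §3] -/
theorem stub_wardWindowSound : WardD4WindowSound :=
  Summit.Ventures.CertifiedManyBodySolver.Theorems.WardSlotM83.stub_wardWindowSound

/-- **Stub 2 [DISCHARGED, rev 4] — SLACK ABSORPTION (Jansson–Chaykin–Keil Lemma 3.1 transplanted to the window
algebra): from the exact reader to the slack reader.** LANDED as `Theorems.WardSlotM83.stub_slackAbsorb` (p613744, file
`Theorems/M3x2EdgeSplitLowerEdge_ge_m83o100SlackAbsorb.lean`, hub-lb-sym-eng-3: `fun h => WardSlot.stub_slackAbsorb h`,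
re-exporting the −4/5 item's `Theorems.WardSlot.stub_slackAbsorb` p613156 = hub-lb-sym-ref-1's `SlackAbsorb.lean`
8686c191df574d56: square roots `CFC.sqrt` of the SOS defects, the exact reader fed with generators `Sum.elim O F` on
`σ ⊕ σ`, PSD multiplier `fromBlocks (blockDiagonal' (Z k + δ_k•1)) 0 0 (diagonal δ)` via the landed helpers
`posSemidef_fromBlocks_diag` / `posSemidef_blockDiagonal'` / `gramForm_fromBlocks_diag` / `gramForm_diagonal`, constant
`c − Σ_k δ_k Σ_i r²`). Its codomain `Theorems.WardSlot.WardSlackWindowBound` is a verbatim copy of §1's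
`WardSlackWindowBound` (hub-lb-sym-ref-1 text diff ∅; hub-lb-dual-ref-2 `rfl`). No longer a registered stub.
[cite: JanssonChaykinKeil2008, Lemma 3.1] -/
theorem stub_slackAbsorb : WardD4WindowSound → WardSlackWindowBound :=
  fun h => Summit.Ventures.CertifiedManyBodySolver.Theorems.WardSlotM83.stub_slackAbsorb h

/-- **Stub 3 [L] — the near-certificate of value `≥ −83/100` at (1, 0, 8, 7/8) EXISTS.** See
`NearCertWardSlack_m83o100`. Met BY VALUE outside Lean by CERTIFIED #529 (−0.8295699476, margin 4.3·10⁻⁴; its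
1 660 885 `SU(2)`-Ward rows enter through `Xp`/`Xm`, its exact `LLᵀ` Gram through `δ = 0`); the Lean witness is
a replayable edition, or the re-rounded XSTAR/MENU export with per-block PSD floors priced `Σ_k δ_k Σ_i r_ki² ≤
4.3·10⁻⁴` (crit-1 P2). Why it might fail: every edition small enough to replay in the kernel may fall below −0.83
(MENU-LITE #513 = −0.8315 does; the margin lives in MENU's last 3 328 + 2 128 words), and at `r_i = ‖B_i‖₁ ≤ 8`
the affordable floor is `≲ 10⁻⁹`-class. [cite: Han2020Bootstrap, §3; WangEtAl2024, §III] -/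
theorem stub_nearCert_m83o100 : NearCertWardSlack_m83o100 := by
  sorry

/-! ## §3 The composition (kernel-checked; no sorry outside the stubs) -/

/-- **Composition, hypotheses form.** The three stub STATEMENTS give the certified lower row `lo = -83 / 100`:
read stub 3's near-certificate with the slack reader (stub 2 applied to stub 1) at `(t,t',U,n) = (1,0,8,7/8)`.
(Concludes the unfolded statement, so that exactly ONE theorem of this file concludes the crux by name.) [folklore] -/
theorem exists_lowerRow_of_stubs :
    WardD4WindowSound → (WardD4WindowSound → WardSlackWindowBound) → NearCertWardSlack_m83o100 →
      ∃ lo : ℚ, (-83 / 100 : ℚ) ≤ lo ∧ Summit.Ventures.CertifiedManyBodySolver.M3EnergyLowerRow 0 lo := by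
  intro h₁ h₂ h₃
  have hS : WardSlackWindowBound := h₂ h₁
  obtain ⟨Λ, Λ', hΛ, h8, h0, hz, μ, nb, msz, Z, δs, hδ, hZ, O, r, hO, ns, B, nt, γ, wv, hsh, Y, nu, b, cw, hcw,
    np, Xp, nm', Xm, na, dc, V, nw, a, word, c, hcert, hval⟩ := h₃
  have hb := hS 1 0 8 (by norm_num) (7 / 8) (by norm_num) (by norm_num) Λ Λ' hΛ h8 h0 hz μ
    (Fin nb) inferInstance inferInstance (fun k => Fin (msz k)) inferInstance inferInstance Z δs hδ hZ O r hO
    (Fin ns) Finset.univ B (Fin nt) Finset.univ γ wv hsh Y (Fin nu) Finset.univ b cw hcw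
    (Fin np) Finset.univ Xp (Fin nm') Finset.univ Xm (Fin na) Finset.univ dc V (Fin nw) Finset.univ a word c hcert
  refine ⟨-83 / 100, le_rfl, ?_⟩
  unfold Summit.Ventures.CertifiedManyBodySolver.M3EnergyLowerRow
  have hcast : (((-83 / 100 : ℚ) : ℚ) : ℝ) = (-83 / 100 : ℝ) := by push_cast; ring
  rw [hcast]
  linarith

/-- **THE SKELETON THEOREM.** The crux `M3x2EdgeSplit.LowerEdge_ge_m83o100` — BY NAME — from the three stub theorems
`stub_wardWindowSound`, `stub_slackAbsorb` (both DISCHARGED by landed theorems since rev 4) and `stub_nearCert_m83o100`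
(the ONE registered stub = the only sorry of this file) through `exists_lowerRow_of_stubs`. [folklore] -/
theorem LowerEdge_ge_m83o100_of : Summit.Ventures.CertifiedManyBodySolver.Theses.M3x2EdgeSplit.LowerEdge_ge_m83o100 := by
  unfold Summit.Ventures.CertifiedManyBodySolver.Theses.M3x2EdgeSplit.LowerEdge_ge_m83o100
  exact exists_lowerRow_of_stubs stub_wardWindowSound stub_slackAbsorb stub_nearCert_m83o100

end Summit.Ventures.CertifiedManyBodySolver.Cruxes.LowerEdge_ge_m83o100.FoDualRounding
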